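import Summits.QuantumFields.YangMills.Theorems.LuscherReductionDressedRitzPolyakovLiftPScalingLevels
import Summits.QuantumFields.YangMills.Theorems.LuscherReductionDressedRitzPolyakovLiftDressed
import Summits.QuantumFields.YangMills.Theorems.LuscherReductionDressedRitzPlateauCertificates
import HarnessLib

/-!
# Route `LuscherReduction`, item `DressedRitz` (stmt-QuantumFields-20205), line «polyakovlift» r8 — the ONE-SITE SIDE CONDITIONS of the
# block-to-fine assembly (seat ym-20205-polyakovlift-w1a g16 on the LEAD's WAKE W4-A §3∕§4; helper `--supports stmt-QuantumFields-20205`)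

The per-basis engine `PolyakovLift.dynamicCoreClauses_of_block` (`…PolyakovLiftBlockPositionGlue.lean`) turns BLOCK data into the fine dynamic core
(o5)(o6) of a dressed family, given three SIDE CONDITIONS on the block Rayleigh quotients `X_i = ⟨u_i,K^{L}u_i⟩/‖u_i‖²` — comparability `X_i ≤ Θ₁X_l`,
mismatch `|X_i − X_l| ≤ ηX_l`, top `λ₀^L ≤ Θ₁X_i` — and two `O(λ²)` budgets.  This file discharges them from the block position (B5)
(`X_i·μ₀^L = e^{±a}(μ_{i+1}λ₀)^L·‖u_i‖²`) and the closed crux ONE (`PScal.levels_package k`: `μ_j = ν e^{−ε_{j+1}x ± Cx²}`, `x = bareLambda B = λ/L`):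

* §1 pure real: `side_of_sandwich` (from `X_i ≤ P·T`, `T ≤ Q·X_i` for all channels: comparability and top
  at `PQ`, mismatch at `PQ − 1`);
* §2 ★ `levelPow_sandwich`: for `B = oneSiteCoupling β L ≥ B₁(k)` and `λ ≤ 1`, every `j ≤ k` has `e^{−(ε_{k+1}+2C)λ}·μ₀^L ≤ μ_j^L ≤ e^{2Cλ}·μ₀^L`
  (`L = dressSteps L`; the `L`-th power of the one-site level ratio is an `L`-FREE number because `x·L = λ`);
* §3 ★★ `block_side_package k A`: constants `Θ₁ ≥ 1`, `C_η ≥ 0`, `B₁ > 0` (functions of `k, A` only) such that on every lattice with `B(β,L) ≥ B₁`,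
  `0 < λ ≤ 1`, every family `u` with `‖u_i‖² > 0` and (B5) at `e^{a}`, `0 ≤ a ≤ A·λ`, satisfies the three side conditions VERBATIM in the currency of
  `dynamicCoreClauses_of_block` with `Θ₁` and `η = C_η·λ`;
* §4 budgets `budget_C5`, `budget_C6` (pure real: with `a = E = C_Bλ²`, `δ = C_δλ³`, `s = C_Sλ`, `η = C_ηλ`, `λ ≤ 1`, both door budgets are `≤ C'λ²` for
  explicit `C'`), and the window bookkeeping `window_small` (`lam ≤ lamW(B₁)` ⟹ `B(β,L) ≥ B₁ ∧ 0 < λ ≤ 1`).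

HONEST FRAMING: elementary bookkeeping on a fixed lattice for the CONDITIONAL femto rung R2b1 (inputs: the closed crux ONE and the OPEN block text (B5));
nothing here bears on infinite volume, the continuum limit or the Clay gap.  References: M. Lüscher, NPB 219 (1983) 233 [cite: Luscher1983, §3].
-/

set_option autoImplicit false

noncomputable section

open MeasureTheory Filter Topology Real
open Literature.MathematicalPhysics.QuantumFieldTheory (GaugeConfig Site gaugeTransform)
open Literature.Analysis.OperatorTheory.YMMatrixModel
open scoped BigOperators

namespace Summit.QuantumFields.YangMills.Theorems.FemtoTransferGap.PolyakovLift

open Summit.QuantumFields.YangMills.Theorems.FemtoTransferGap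

/-! ## §1 Pure real lemmas -/

/-- SANDWICH ⟹ SIDE CONDITIONS (pure real): if every channel's block quotient satisfies `X_i ≤ P·T` and `T ≤ Q·X_i` (`P, Q ≥ 1`, `T > 0`), then
`X_i ≤ PQ·X_l`, `|X_i − X_l| ≤ (PQ − 1)·X_l` and `T ≤ PQ·X_i`. [folklore] -/
theorem side_of_sandwich {k : ℕ} {X : Fin k → ℝ} {P Q T : ℝ} (hP : 1 ≤ P) (hQ : 1 ≤ Q) (hT : 0 < T)
    (hup : ∀ i, X i ≤ P * T) (hlo : ∀ i, T ≤ Q * X i) :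
    (∀ i l : Fin k, X i ≤ P * Q * X l) ∧ (∀ i l : Fin k, |X i - X l| ≤ (P * Q - 1) * X l) ∧ (∀ i : Fin k, T ≤ P * Q * X i) := by
  have hQ0 : 0 < Q := by linarith
  have hPQ : 1 ≤ P * Q := by nlinarith
  have hXpos : ∀ i, 0 < X i := fun i => (mul_pos_iff_of_pos_left hQ0).1 (hT.trans_le (hlo i))
  have hcmp : ∀ i l : Fin k, X i ≤ P * Q * X l := fun i l =>
    calc X i ≤ P * T := hup i
      _ ≤ P * (Q * X l) := mul_le_mul_of_nonneg_left (hlo l) (by linarith)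
      _ = P * Q * X l := by ring
  refine ⟨hcmp, fun i l => ?_, fun i => ?_⟩
  · rw [abs_le]
    constructor
    · -- `X_l ≤ PQ·X_i` and `(2 − t)·t ≤ 1` give `(2 − PQ)·X_l ≤ X_i`
      have h1 : X l ≤ P * Q * X i := hcmp l i
      have hXl := (hXpos l).le
      have h2 : (2 - P * Q) * (P * Q) * X l ≤ 1 * X l :=
        mul_le_mul_of_nonneg_right (by nlinarith [sq_nonneg (P * Q - 1)]) hXl
      have h3 : (2 - P * Q) * X l * (P * Q) ≤ X i * (P * Q) := by nlinarith
      have h4 : (2 - P * Q) * X l ≤ X i := le_of_mul_le_mul_right h3 (by linarith)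
      linarith
    · linarith [hcmp i l]
  · calc T ≤ Q * X i := hlo i
      _ ≤ P * Q * X i := by rw [mul_assoc]; exact le_mul_of_one_le_left (mul_nonneg hQ0.le (hXpos i).le) hP

/-! ## §2 ★ The `L`-th power of the one-site level ratio is an `L`-free number -/

/-- ★ **LEVEL-POWER SANDWICH from the closed crux ONE.**  There are `C ≥ 0` and `B₁ > 0` (functions of `k`) such that whenever `B(β,L) ≥ B₁` and
`0 < λ(β,L) ≤ 1`: `μ₀ > 0` and for every `j ≤ k`, with `μ_j = levelValue su2Rep 1 (oneSiteCoupling β L) j` and `L' = dressSteps L`,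
`e^{−(ε_{k+1} + 2C)λ}·μ₀^{L'} ≤ μ_j^{L'} ≤ e^{2Cλ}·μ₀^{L'}` (`ε_{k+1} = physLevel (k+1)`).  Proof: `μ_j = ν e^{−ε_{j+1}x ± Cx²}` (`PScal.levels_package`) with
`x = bareLambda B = λ/L` (`bareLambda_oneSiteCoupling`), so `L·x = λ` and `L·x² ≤ λ`. [cite: Luscher1983, §2] -/
theorem levelPow_sandwich (k : ℕ) : ∃ C B₁ : ℝ, 0 ≤ C ∧ 0 < B₁ ∧ ∀ (L : ℕ) [NeZero L] (β : ℝ),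
    B₁ ≤ oneSiteCoupling β L → 0 < luscherLambda β L → luscherLambda β L ≤ 1 →
      0 < levelValue su2Rep 1 (oneSiteCoupling β L) 0 ∧
      ∀ j : ℕ, j ≤ k →
        Real.exp (-((physLevel (k + 1) + 2 * C) * luscherLambda β L)) * levelValue su2Rep 1 (oneSiteCoupling β L) 0 ^ dressSteps L ≤
            levelValue su2Rep 1 (oneSiteCoupling β L) j ^ dressSteps L ∧
        levelValue su2Rep 1 (oneSiteCoupling β L) j ^ dressSteps L ≤
            Real.exp (2 * C * luscherLambda β L) * levelValue su2Rep 1 (oneSiteCoupling β L) 0 ^ dressSteps L := by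
  obtain ⟨C, cgap, Ctop, x₀, B₁, hC, -, -, -, hB₁, hpk⟩ := PScal.levels_package k
  refine ⟨C, B₁, hC, hB₁, fun L _ β hB hl hl1 => ?_⟩
  obtain ⟨hx, -, hν, -, hab, -, -⟩ := hpk _ hB
  set B := oneSiteCoupling β L with hBdef
  set x := bareLambda B with hxdef
  set ν := linkC B ^ 3 with hνdef
  have hLpos : (0 : ℝ) < L := Nat.cast_pos.mpr (NeZero.pos L)
  have hL1 : (1 : ℝ) ≤ L := by exact_mod_cast (NeZero.one_le : 1 ≤ L)
  have hxeq : x = luscherLambda β L / L := bareLambda_oneSiteCoupling hl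
  have hLx : (L : ℝ) * x = luscherLambda β L := by rw [hxeq]; field_simp
  have hx1 : x ≤ 1 := by rw [hxeq, div_le_one hLpos]; exact hl1.trans hL1
  have hLx2 : (L : ℝ) * x ^ 2 ≤ luscherLambda β L := by
    calc (L : ℝ) * x ^ 2 = (L * x) * x := by ring
      _ ≤ (L * x) * 1 := mul_le_mul_of_nonneg_left hx1 (by rw [hLx]; exact hl.le)
      _ = luscherLambda β L := by rw [mul_one, hLx]
  have hE0 : 0 ≤ physLevel 1 := physLevel_nonneg le_rfl
  have hEk : ∀ j, j ≤ k → physLevel (j + 1) ≤ physLevel (k + 1) := fun j hj =>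
    physLevel_mono (Nat.succ_le_succ (Nat.zero_le j)) (Nat.succ_le_succ hj)
  have hEj0 : ∀ j, physLevel 1 ≤ physLevel (j + 1) := fun j => physLevel_mono le_rfl (Nat.succ_le_succ (Nat.zero_le j))
  obtain ⟨h0lo, h0up, h0pos⟩ := hab 0 (Nat.zero_le k)
  refine ⟨h0pos, fun j hj => ?_⟩
  obtain ⟨hjlo, hjup, hjpos⟩ := hab j hj
  -- per-level ratio bounds
  have hup1 : levelValue su2Rep 1 B j ≤ Real.exp (2 * C * x ^ 2) * levelValue su2Rep 1 B 0 := by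
    calc levelValue su2Rep 1 B j ≤ ν * Real.exp (-(physLevel (j + 1) * x) + C * x ^ 2) := hjup
      _ ≤ ν * Real.exp (-(physLevel (0 + 1) * x) + C * x ^ 2) := by
          refine mul_le_mul_of_nonneg_left (Real.exp_le_exp.2 ?_) hν.le
          nlinarith [hEj0 j, hx.le]
      _ = Real.exp (2 * C * x ^ 2) * (ν * Real.exp (-(physLevel (0 + 1) * x) - C * x ^ 2)) := by
          rw [mul_left_comm, ← Real.exp_add]; congr 2; ring
      _ ≤ Real.exp (2 * C * x ^ 2) * levelValue su2Rep 1 B 0 := mul_le_mul_of_nonneg_left h0lo (Real.exp_pos _).le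
  have hlo1 : Real.exp (-(physLevel (k + 1) * x + 2 * C * x ^ 2)) * levelValue su2Rep 1 B 0 ≤ levelValue su2Rep 1 B j := by
    calc Real.exp (-(physLevel (k + 1) * x + 2 * C * x ^ 2)) * levelValue su2Rep 1 B 0
        ≤ Real.exp (-(physLevel (k + 1) * x + 2 * C * x ^ 2)) * (ν * Real.exp (-(physLevel (0 + 1) * x) + C * x ^ 2)) :=
          mul_le_mul_of_nonneg_left h0up (Real.exp_pos _).le
      _ = ν * (Real.exp (-(physLevel (k + 1) * x + 2 * C * x ^ 2)) * Real.exp (-(physLevel (0 + 1) * x) + C * x ^ 2)) := by ring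
      _ = ν * Real.exp (-(physLevel (k + 1) * x + 2 * C * x ^ 2) + (-(physLevel (0 + 1) * x) + C * x ^ 2)) := by
          rw [← Real.exp_add]
      _ ≤ ν * Real.exp (-(physLevel (j + 1) * x) - C * x ^ 2) := by
          refine mul_le_mul_of_nonneg_left (Real.exp_le_exp.2 ?_) hν.le
          have := hEk j hj
          nlinarith [hE0, hx.le]
      _ ≤ levelValue su2Rep 1 B j := hjlo
  -- powers
  have hm0 : 0 ≤ levelValue su2Rep 1 B 0 := h0pos.le
  constructor
  · have hpow := pow_le_pow_left₀ (by positivity) hlo1 (dressSteps L)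
    rw [mul_pow, ← Real.exp_nat_mul] at hpow
    refine le_trans (mul_le_mul_of_nonneg_right (Real.exp_le_exp.2 ?_) (pow_nonneg hm0 _)) hpow
    change -((physLevel (k + 1) + 2 * C) * luscherLambda β L) ≤ (L : ℝ) * (-(physLevel (k + 1) * x + 2 * C * x ^ 2))
    have h1 : (L : ℝ) * (-(physLevel (k + 1) * x + 2 * C * x ^ 2)) = -(physLevel (k + 1) * (L * x)) - 2 * C * (L * x ^ 2) := by ring
    rw [h1, hLx]
    nlinarith [hLx2, mul_le_mul_of_nonneg_left hLx2 hC]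
  · have hpow := pow_le_pow_left₀ hjpos.le hup1 (dressSteps L)
    rw [mul_pow, ← Real.exp_nat_mul] at hpow
    refine hpow.trans (mul_le_mul_of_nonneg_right (Real.exp_le_exp.2 ?_) (pow_nonneg hm0 _))
    change (L : ℝ) * (2 * C * x ^ 2) ≤ 2 * C * luscherLambda β L
    nlinarith [hLx2]

/-! ## §3 ★★ The side conditions of `dynamicCoreClauses_of_block` from (B5) and ONE -/

/-- ★★ **THE ONE-SITE SIDE CONDITIONS, PACKAGED.**  For every `k` and every `A ≥ 0` there are `Θ₁ ≥ 1`, `C_η ≥ 0`, `B₁ > 0` (functions of `k, A` only) such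
that on every lattice `L` at every coupling `β > 0` with `B(β,L) ≥ B₁` and `0 < λ(β,L) ≤ 1`, every family `u : Fin k → _` with `‖u_i‖² > 0` and BLOCK
POSITION (B5) at `e^{a}`, `0 ≤ a ≤ A·λ` — `⟨u_i,Pu_i⟩μ₀^{L'} ≤ e^{a}(μ_{i+1}λ₀)^{L'}‖u_i‖²` and `(μ_{i+1}λ₀)^{L'}‖u_i‖² ≤ e^{a}⟨u_i,Pu_i⟩μ₀^{L'}` (`P = K^{L'}`,
`L' = dressSteps L`) — has block quotients `X_i = ⟨u_i,Pu_i⟩/‖u_i‖²` with: COMPARABILITY `X_i ≤ Θ₁X_l`, MISMATCH `|X_i − X_l| ≤ C_ηλ·X_l`, TOP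
`λ₀^{L'} ≤ Θ₁X_i` — the three side hypotheses `hcmp`, `hmis`, `htop` of `dynamicCoreClauses_of_block` VERBATIM (`η = C_ηλ`).  Constants:
`Θ₁ = exp(2A + ε_{k+1} + 4C)`, `C_η = (2A + ε_{k+1} + 4C)Θ₁` with `C, B₁` from `levelPow_sandwich k`. [cite: Luscher1983, §3] -/
theorem block_side_package (k : ℕ) {A : ℝ} (hA : 0 ≤ A) : ∃ Θ₁ Cη B₁ : ℝ, 1 ≤ Θ₁ ∧ 0 ≤ Cη ∧ 0 < B₁ ∧
    ∀ (L : ℕ) [NeZero L] (β : ℝ), 0 < β → B₁ ≤ oneSiteCoupling β L → 0 < luscherLambda β L → luscherLambda β L ≤ 1 →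
      ∀ (u : Fin k → (GaugeConfig 3 L SU2 → ℝ)) (a : ℝ), 0 ≤ a → a ≤ A * luscherLambda β L →
        (∀ i : Fin k, 0 < l2 (u i) (u i)) →
        (∀ i : Fin k,
          l2 (u i) ((transferApply β)^[dressSteps L] (u i)) * levelValue su2Rep 1 (oneSiteCoupling β L) 0 ^ dressSteps L ≤
              Real.exp a * (levelValue su2Rep 1 (oneSiteCoupling β L) ((i : ℕ) + 1) * levelValue su2Rep L β 0) ^ dressSteps L * l2 (u i) (u i) ∧
          (levelValue su2Rep 1 (oneSiteCoupling β L) ((i : ℕ) + 1) * levelValue su2Rep L β 0) ^ dressSteps L * l2 (u i) (u i) ≤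
              Real.exp a * (l2 (u i) ((transferApply β)^[dressSteps L] (u i)) * levelValue su2Rep 1 (oneSiteCoupling β L) 0 ^ dressSteps L)) →
        (∀ i l : Fin k,
          l2 (u i) ((transferApply β)^[dressSteps L] (u i)) / l2 (u i) (u i) ≤
            Θ₁ * (l2 (u l) ((transferApply β)^[dressSteps L] (u l)) / l2 (u l) (u l))) ∧
        (∀ i l : Fin k,
          |l2 (u i) ((transferApply β)^[dressSteps L] (u i)) / l2 (u i) (u i) -
              l2 (u l) ((transferApply β)^[dressSteps L] (u l)) / l2 (u l) (u l)| ≤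
            Cη * luscherLambda β L * (l2 (u l) ((transferApply β)^[dressSteps L] (u l)) / l2 (u l) (u l))) ∧
        (∀ i : Fin k, levelValue su2Rep L β 0 ^ dressSteps L ≤
            Θ₁ * (l2 (u i) ((transferApply β)^[dressSteps L] (u i)) / l2 (u i) (u i))) := by
  obtain ⟨C, B₁, hC, hB₁, hlev⟩ := levelPow_sandwich k
  set Ek : ℝ := physLevel (k + 1) with hEk
  have hEk0 : 0 ≤ Ek := physLevel_nonneg (Nat.succ_le_succ (Nat.zero_le k))
  set κ : ℝ := 2 * A + Ek + 4 * C with hκ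
  have hκ0 : 0 ≤ κ := by positivity
  set Θ₁ : ℝ := Real.exp κ with hΘ₁
  have hΘ₁1 : 1 ≤ Θ₁ := Real.one_le_exp hκ0
  refine ⟨Θ₁, κ * Θ₁, B₁, hΘ₁1, by positivity, hB₁, fun L _ β hβ hB hl hl1 u a ha0 haA hn hB5 => ?_⟩
  obtain ⟨hm0, hj⟩ := hlev L β hB hl hl1
  set lam := luscherLambda β L with hlam
  set m0 := levelValue su2Rep 1 (oneSiteCoupling β L) 0 with hm0def
  set l0 := levelValue su2Rep L β 0 with hl0def
  set T := l0 ^ dressSteps L with hT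
  have hl0 : 0 < l0 := levelValue_su2Rep_pos hβ 0
  have hTpos : 0 < T := pow_pos hl0 _
  have hM : 0 < m0 ^ dressSteps L := pow_pos hm0 _
  set X : Fin k → ℝ := fun i => l2 (u i) ((transferApply β)^[dressSteps L] (u i)) / l2 (u i) (u i) with hX
  set P := Real.exp (a + 2 * C * lam) with hP
  set Q := Real.exp (a + (Ek + 2 * C) * lam) with hQ
  have hP1 : 1 ≤ P := Real.one_le_exp (by positivity)
  have hQ1 : 1 ≤ Q := Real.one_le_exp (by positivity)
  -- the sandwich for every channel
  have hsand : ∀ i : Fin k, X i ≤ P * T ∧ T ≤ Q * X i := by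
    intro i
    have hik : (i : ℕ) + 1 ≤ k := i.is_lt
    obtain ⟨hμlo, hμup⟩ := hj ((i : ℕ) + 1) hik
    obtain ⟨h5a, h5b⟩ := hB5 i
    have hni := hn i
    have hXi : X i * l2 (u i) (u i) = l2 (u i) ((transferApply β)^[dressSteps L] (u i)) := div_mul_cancel₀ _ hni.ne'
    rw [mul_pow] at h5a h5b
    constructor
    · -- X m0^L ≤ e^a μ^L T ≤ e^a e^{2Cλ} m0^L T
      have h1 : X i * m0 ^ dressSteps L * l2 (u i) (u i) ≤ (P * T) * m0 ^ dressSteps L * l2 (u i) (u i) := by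
        calc X i * m0 ^ dressSteps L * l2 (u i) (u i)
            = l2 (u i) ((transferApply β)^[dressSteps L] (u i)) * m0 ^ dressSteps L := by rw [← hXi]; ring
          _ ≤ Real.exp a * (levelValue su2Rep 1 (oneSiteCoupling β L) ((i : ℕ) + 1) ^ dressSteps L * T) * l2 (u i) (u i) := h5a
          _ ≤ Real.exp a * (Real.exp (2 * C * lam) * m0 ^ dressSteps L * T) * l2 (u i) (u i) := by
              refine mul_le_mul_of_nonneg_right (mul_le_mul_of_nonneg_left ?_ (Real.exp_pos _).le) hni.le
              exact mul_le_mul_of_nonneg_right hμup hTpos.le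
          _ = (P * T) * m0 ^ dressSteps L * l2 (u i) (u i) := by rw [hP, Real.exp_add]; ring
      exact le_of_mul_le_mul_right (le_of_mul_le_mul_right h1 hni) hM
    · -- e^{-c₂λ} m0^L T n ≤ μ^L T n ≤ e^a X m0^L n
      have h1 : Real.exp (-((Ek + 2 * C) * lam)) * T * m0 ^ dressSteps L * l2 (u i) (u i) ≤
          Real.exp a * X i * m0 ^ dressSteps L * l2 (u i) (u i) := by
        calc Real.exp (-((Ek + 2 * C) * lam)) * T * m0 ^ dressSteps L * l2 (u i) (u i)
            = (Real.exp (-((Ek + 2 * C) * lam)) * m0 ^ dressSteps L) * T * l2 (u i) (u i) := by ring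
          _ ≤ levelValue su2Rep 1 (oneSiteCoupling β L) ((i : ℕ) + 1) ^ dressSteps L * T * l2 (u i) (u i) :=
              mul_le_mul_of_nonneg_right (mul_le_mul_of_nonneg_right hμlo hTpos.le) hni.le
          _ ≤ Real.exp a * (l2 (u i) ((transferApply β)^[dressSteps L] (u i)) * m0 ^ dressSteps L) := h5b
          _ = Real.exp a * X i * m0 ^ dressSteps L * l2 (u i) (u i) := by rw [← hXi]; ring
      have h2 : Real.exp (-((Ek + 2 * C) * lam)) * T ≤ Real.exp a * X i :=
        le_of_mul_le_mul_right (le_of_mul_le_mul_right h1 hni) hM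
      have h3 : Real.exp (a + (Ek + 2 * C) * lam) * (Real.exp (-((Ek + 2 * C) * lam)) * T) = Real.exp a * T := by
        rw [← mul_assoc, ← Real.exp_add]; congr 1; ring_nf
      calc T = Real.exp (-a) * (Real.exp a * T) := by rw [← mul_assoc, ← Real.exp_add, neg_add_cancel, Real.exp_zero, one_mul]
        _ = Real.exp (-a) * (Real.exp (a + (Ek + 2 * C) * lam) * (Real.exp (-((Ek + 2 * C) * lam)) * T)) := by rw [h3]
        _ ≤ Real.exp (-a) * (Real.exp (a + (Ek + 2 * C) * lam) * (Real.exp a * X i)) :=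
            mul_le_mul_of_nonneg_left (mul_le_mul_of_nonneg_left h2 (Real.exp_pos _).le) (Real.exp_pos _).le
        _ = Q * X i := by
            rw [hQ, ← mul_assoc, ← mul_assoc, ← Real.exp_add, ← Real.exp_add]; congr 1; ring_nf
  obtain ⟨hcmp, hmis, htop⟩ := side_of_sandwich hP1 hQ1 hTpos (fun i => (hsand i).1) (fun i => (hsand i).2)
  -- `PQ ≤ Θ₁` and `PQ − 1 ≤ κΘ₁λ`
  have hlam1 : lam ≤ 1 := hl1
  have hPQ : P * Q = Real.exp (2 * a + (Ek + 4 * C) * lam) := by rw [hP, hQ, ← Real.exp_add]; congr 1; ring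
  have hexp_le : 2 * a + (Ek + 4 * C) * lam ≤ κ * lam := by
    rw [hκ]; nlinarith [haA]
  have hκlam : κ * lam ≤ κ := by nlinarith
  have hPQΘ : P * Q ≤ Θ₁ := by rw [hPQ, hΘ₁]; exact Real.exp_le_exp.2 (hexp_le.trans hκlam)
  have hPQη : P * Q - 1 ≤ κ * Θ₁ * lam := by
    have h0 : 0 ≤ 2 * a + (Ek + 4 * C) * lam := by positivity
    -- `e^t − 1 ≤ t e^t` (also `Literature…AreaLaw.exp_sub_one_le_mul_exp`; two lines, not worth the import)
    have hexp1 : ∀ t : ℝ, Real.exp t - 1 ≤ t * Real.exp t := fun t => by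
      have h1 : 1 - t ≤ Real.exp (-t) := by linarith [Real.add_one_le_exp (-t)]
      have h2 : Real.exp t * Real.exp (-t) = 1 := by rw [← Real.exp_add, add_neg_cancel, Real.exp_zero]
      nlinarith [Real.exp_pos t, mul_le_mul_of_nonneg_left h1 (Real.exp_pos t).le]
    calc P * Q - 1 ≤ (2 * a + (Ek + 4 * C) * lam) * (P * Q) := by rw [hPQ]; exact hexp1 _
      _ ≤ (κ * lam) * Θ₁ := mul_le_mul hexp_le hPQΘ (by rw [hPQ]; exact (Real.exp_pos _).le) (by positivity)
      _ = κ * Θ₁ * lam := by ring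
  have hXpos : ∀ i, 0 ≤ X i := fun i =>
    ((mul_pos_iff_of_pos_left (lt_of_lt_of_le one_pos hQ1)).1 (hTpos.trans_le (hsand i).2)).le
  refine ⟨fun i l => (hcmp i l).trans (mul_le_mul_of_nonneg_right hPQΘ (hXpos l)),
    fun i l => (hmis i l).trans (mul_le_mul_of_nonneg_right hPQη (hXpos l)),
    fun i => (htop i).trans (mul_le_mul_of_nonneg_right hPQΘ (hXpos i))⟩

/-! ## §4 The two door budgets are `O(λ²)`; window bookkeeping -/

/-- BUDGET (o5): `a + 15δ ≤ (C_B + 15C_δ)λ²` for `a ≤ C_Bλ²`, `δ ≤ C_δλ³`, `λ ≤ 1`, `C_δ ≥ 0`. [folklore] -/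
theorem budget_C5 {a δ CB Cδ lam : ℝ} (hCδ : 0 ≤ Cδ) (hlam1 : lam ≤ 1)
    (ha : a ≤ CB * lam ^ 2) (hδ : δ ≤ Cδ * lam ^ 3) : a + 15 * δ ≤ (CB + 15 * Cδ) * lam ^ 2 := by
  have h3 : lam ^ 3 ≤ lam ^ 2 := by nlinarith [sq_nonneg lam]
  nlinarith [mul_le_mul_of_nonneg_left h3 hCδ]

/-- BUDGET (o6): with `E ≤ C_Bλ²`, `0 ≤ δ ≤ C_δλ³`, `0 ≤ s ≤ C_Sλ`, `0 ≤ η ≤ C_ηλ`, `Θ₁ ≥ 1`, `C_δ, C_η ≥ 0`, `0 ≤ λ ≤ 1`, the cross-door budget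
`2Θ₁E + 2Θ₁(η+15δ)s + (32(2Θ₁)⁴+8(2Θ₁))δ + 128(2Θ₁)²(η+15δ)²` is at most `C₆λ²`,
`C₆ = 2Θ₁C_B + 2Θ₁(C_η+15C_δ)C_S + (32(2Θ₁)⁴+8(2Θ₁))C_δ + 128(2Θ₁)²(C_η+15C_δ)²`. [folklore] -/
theorem budget_C6 {E δ s η Θ₁ CB Cδ CS Cη lam : ℝ} (hΘ₁ : 1 ≤ Θ₁) (hCδ : 0 ≤ Cδ) (hCη : 0 ≤ Cη)
    (hlam0 : 0 ≤ lam) (hlam1 : lam ≤ 1) (hE : E ≤ CB * lam ^ 2) (hδ0 : 0 ≤ δ) (hδ : δ ≤ Cδ * lam ^ 3) (hs0 : 0 ≤ s) (hs : s ≤ CS * lam)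
    (hη0 : 0 ≤ η) (hη : η ≤ Cη * lam) :
    2 * Θ₁ * E + 2 * Θ₁ * (η + 15 * δ) * s + ((32 * (2 * Θ₁) ^ 4 + 8 * (2 * Θ₁)) * δ + 128 * (2 * Θ₁) ^ 2 * (η + 15 * δ) ^ 2) ≤
      (2 * Θ₁ * CB + 2 * Θ₁ * (Cη + 15 * Cδ) * CS + ((32 * (2 * Θ₁) ^ 4 + 8 * (2 * Θ₁)) * Cδ + 128 * (2 * Θ₁) ^ 2 * (Cη + 15 * Cδ) ^ 2)) *
        lam ^ 2 := by
  have hΘ0 : 0 ≤ Θ₁ := by linarith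
  have h32 : lam ^ 3 ≤ lam ^ 2 := by nlinarith [sq_nonneg lam]
  have h31 : lam ^ 3 ≤ lam := by nlinarith [sq_nonneg lam]
  have hw : η + 15 * δ ≤ (Cη + 15 * Cδ) * lam := by nlinarith [mul_le_mul_of_nonneg_left h31 hCδ]
  have hw0 : 0 ≤ η + 15 * δ := by positivity
  -- term by term
  have t1 : 2 * Θ₁ * E ≤ 2 * Θ₁ * CB * lam ^ 2 := by nlinarith [mul_le_mul_of_nonneg_left hE hΘ0]
  have t2 : 2 * Θ₁ * (η + 15 * δ) * s ≤ 2 * Θ₁ * (Cη + 15 * Cδ) * CS * lam ^ 2 := by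
    have := mul_le_mul hw hs hs0 (by positivity)
    nlinarith [mul_le_mul_of_nonneg_left this hΘ0]
  have t3 : (32 * (2 * Θ₁) ^ 4 + 8 * (2 * Θ₁)) * δ ≤ (32 * (2 * Θ₁) ^ 4 + 8 * (2 * Θ₁)) * Cδ * lam ^ 2 := by
    have hc : 0 ≤ 32 * (2 * Θ₁) ^ 4 + 8 * (2 * Θ₁) := by positivity
    nlinarith [mul_le_mul_of_nonneg_left (hδ.trans (mul_le_mul_of_nonneg_left h32 hCδ)) hc]
  have t4 : 128 * (2 * Θ₁) ^ 2 * (η + 15 * δ) ^ 2 ≤ 128 * (2 * Θ₁) ^ 2 * (Cη + 15 * Cδ) ^ 2 * lam ^ 2 := by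
    have hsq : (η + 15 * δ) ^ 2 ≤ ((Cη + 15 * Cδ) * lam) ^ 2 := pow_le_pow_left₀ hw0 hw 2
    have hc : 0 ≤ 128 * (2 * Θ₁) ^ 2 := by positivity
    nlinarith [mul_le_mul_of_nonneg_left hsq hc]
  nlinarith [t1, t2, t3, t4]

/-- WINDOW BOOKKEEPING: if `lam ≤ min (1/2) (1/(4·max B₁ 1))` then in the femto window `B(β,L) ≥ B₁` and `0 < λ ≤ 1`.
(`KTGen.oneSiteCoupling_ge_of_small_level`.) [folklore] -/
theorem window_small {B₁ lam β : ℝ} {L : ℕ} [NeZero L] (hlam : 0 < lam) (hle : lam ≤ min (1 / 2) (1 / (4 * max B₁ 1)))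
    (hW : InFemtoWindow lam β L) : B₁ ≤ oneSiteCoupling β L ∧ 0 < luscherLambda β L ∧ luscherLambda β L ≤ 1 := by
  have h1 : lam ≤ 1 / 2 := hle.trans (min_le_left _ _)
  have h2 : lam ≤ 1 / (4 * max B₁ 1) := hle.trans (min_le_right _ _)
  exact ⟨KTGen.oneSiteCoupling_ge_of_small_level hlam (by linarith) h2 hW, luscherLambda_pos_of_window hlam hW, by linarith [hW.2.2]⟩

end Summit.QuantumFields.YangMills.Theorems.FemtoTransferGap.PolyakovLift

end
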